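import Literature.Probability.Percolation.FourArmPivotalLocal
import Literature.Probability.Percolation.AltFourArm
import HarnessLib

/-!
# Pivotal sites of four-arm events: the ALTERNATING local factor is an alternating four-arm probability (proofs only)

Topic `Literature/Probability/Percolation`; family `crit-perc`. PROOFS ONLY (no definition, no
named fact). Companion of `FourArmPivotalAltLocal.lean` (the local event `E(v)` of a pivotal
site in alternating form) and the alternating twin of `FourArmPivotalLocal.lean`, serving the
named fact `Literature.Probability.Percolation.Werner2009_lemma63` (Werner 2009, Lecture 6,
Lemma 6.3) through P. Nolin, *Near-critical percolation in two dimensions*, EJP 13 (2008), §6.2,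
proof of Thm. 27, Case 3 [arXiv 0711.4948: Thm. 26], the display "It implies that
`P̃_t(E(v)) ≤ C₅ P̃_t(v ⇝⁴ ∂S_{2^l}(v))` for some universal constant `C₅`: indeed, by
quasi-multiplicativity, `Σ_{l'} P̃(v ⇝⁴ ∂S_{2^{l'}}) P̃(∂S_{2^{l'+1}} ⇝⁶ ∂S_{2^l})
≤ C₂ Σ_{l'} P̃(v ⇝⁴ ∂S_{2^{l'}}) P̃(∂S_{2^{l'+1}} ⇝⁴ ∂S_{2^l}) 2^{-α'(l-l')} ≤ C₃ P̃(v ⇝⁴ ∂S_{2^l})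
Σ_{l'} 2^{-α'(l-l')} ≤ C₄ P̃(v ⇝⁴ ∂S_{2^l})`". Here the four-arm probabilities are Werner's
ALTERNATING `π̂^alt_t = altFourArmProbAt t` (cluster form), whose quasi-multiplicativity below
`L(p)` follows from alternating separation alone (`altFourArm_quasiMult_of_altSeparation`), whose a
priori lower bound is the theorem `altFourArm_lowerBound`, and the six arms have already been
replaced by `π̂^alt · P(one arm)` through Reimer's inequality in `measureReal_le_of_subset_localAlt`:

* `local_factor_alt_le` — with the three inputs unpacked at the parameter `t` below a radius `N`
  (quasi-multiplicativity `c_Q` for inner radii `≥ r`, lower bound `c_L (m/n)^{2-β}` for `m ≥ r`,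
  one-arm bound `C_A (n/M)^α`) and a scale `l₁ ≥ 1` with `16 r + 1 ≤ 2^{l₁+1}`, `r ≤ 2^{l₁-1}`:
  for every colour `c` and every `l ≥ l₁ + 2` with `2^{l+2} ≤ N`,
  `π̂^alt(1, 2^{l-1}) + π̂^alt(2, 2^l) P(arm_c(2, 2^l))
    + Σ_{1 ≤ l' < l} π̂^alt(1, 2^{l'-1}) π̂^alt(2^{l'+1}, 2^l) P(arm_c(2^{l'+1}, 2^l)) ≤ K π̂^alt(r, 2^l)`
  with the constant `K` of `local_factor_le`. The proof is that of `local_factor_le` line by line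
  (`altFourArmProbAt_mono_left`, `altFourArmProbAt_anti` for the monotonicity in the radii).

## References

* P. Nolin, Near-critical percolation in two dimensions, *Electron. J. Probab.* 13 (2008), §6.2,
  proof of Thm. 27, Case 3 [arXiv 0711.4948: Thm. 26] [Nolin2008].
* W. Werner, *Lectures on two-dimensional critical percolation*, IAS/Park City Math. Ser. 16
  (2009), Lecture 6, §5 ("`≤ c Σ_x π̂_p(‖x‖/2)² π̂_p(2‖x‖, n)`") and Cor. 6.2 [WernerPCMI2009].

Tree: `le_div_of_quasiMult_right/left`, `sum_dyadic_ratio_rpow_le` (`FourArmPivotalLocal.lean`),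
`altFourArmProbAt(_nonneg/_le_one/_anti/_mono_left)` (`AltFourArm.lean`).
-/

noncomputable section

open MeasureTheory Set Finset

namespace Literature.Probability.Percolation

open LatticeModels

section LocalFactor

variable {t : unitInterval} {N r l₁ : ℕ} {cQ cL CA α β : ℝ}

/-- **The alternating local factor of a pivotal site is an alternating four-arm probability**
(Nolin 2008, §6.2, proof of Thm. 27, Case 3: "`P̃_t(E(v)) ≤ C₅ P̃_t(v ⇝⁴ ∂S_{2^l}(v))`"; Werner
2009, Lecture 6, §5). With quasi-multiplicativity of `π̂^alt_t` (`c_Q`, inner radii `≥ r`), the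
lower bound `c_L (m/n)^{2-β} ≤ π̂^alt_t(m, n)` (`m ≥ r`) and the one-arm bound
`P_t(armEvent ![c] n M) ≤ C_A (n/M)^α`, all below the radius `N`, and a scale `l₁ ≥ 1` with
`16 r + 1 ≤ 2^{l₁+1}`, `r ≤ 2^{l₁-1}`: for every colour `c` and every `l ≥ l₁ + 2` with
`2^{l+2} ≤ N`, `L^alt_c(l) ≤ K π̂^alt_t(r, 2^l)`,
`K = 8/(c_Q c_L) · (1 + C_A) + C_A + (C_A/c_Q)(1 + 1/κ₀) · 2^α/(2^α - 1)`,
`κ₀ = c_L (r/2^{l₁-1})^{2-β}`. [cite: Nolin2008, §6.2, proof of Thm. 27, Case 3 (arXiv 0711.4948: Thm. 26, bound on P(E(v)))] [cite: WernerPCMI2009, Lecture 6, §5] -/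
theorem local_factor_alt_le (hcQ : 0 < cQ) (hcL : 0 < cL) (hCA : 0 ≤ CA) (hα : 0 < α) (hβ : 0 < β)
    (hr : 2 ≤ r)
    (hQ : ∀ r' R S : ℕ, r ≤ r' → 16 * r' < 4 * R → 4 * R < S → S ≤ N →
      cQ * (altFourArmProbAt t r' R * altFourArmProbAt t (4 * R) S) ≤ altFourArmProbAt t r' S)
    (hL : ∀ m n : ℕ, r ≤ m → m ≤ n → n ≤ N → cL * ((m : ℝ) / n) ^ (2 - β) ≤ altFourArmProbAt t m n)
    (hA : ∀ (c : Bool) (n M : ℕ), 1 ≤ n → n ≤ M → M ≤ N →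
      (triSitePercolation t).real (armEvent ![c] n M) ≤ CA * ((n : ℝ) / M) ^ α)
    (hl₁ : 1 ≤ l₁) (hl₁r : 16 * r + 1 ≤ 2 ^ (l₁ + 1)) (hl₁r' : r ≤ 2 ^ (l₁ - 1))
    (c : Bool) {l : ℕ} (hl : l₁ + 2 ≤ l) (hlN : 2 ^ (l + 2) ≤ N) :
    altFourArmProbAt t 1 (2 ^ (l - 1)) +
        altFourArmProbAt t 2 (2 ^ l) * (triSitePercolation t).real (armEvent ![c] 2 (2 ^ l)) +
        ∑ l' ∈ Finset.Ico 1 l, altFourArmProbAt t 1 (2 ^ (l' - 1)) *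
          (altFourArmProbAt t (2 ^ (l' + 1)) (2 ^ l) *
            (triSitePercolation t).real (armEvent ![c] (2 ^ (l' + 1)) (2 ^ l))) ≤
      (8 / (cQ * cL) * (1 + CA) + CA +
          CA / cQ * (1 + 1 / (cL * ((r : ℝ) / (2 ^ (l₁ - 1) : ℕ)) ^ (2 - β))) *
            ((2 : ℝ) ^ α / ((2 : ℝ) ^ α - 1))) *
        altFourArmProbAt t r (2 ^ l) := by
  -- notation and positivity
  set μ := triSitePercolation t with hμ
  set π : ℕ → ℕ → ℝ := fun a b => altFourArmProbAt t a b with hπ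
  have hπ0 : ∀ a b, 0 ≤ π a b := fun a b => altFourArmProbAt_nonneg t a b
  have hπ1 : ∀ a b, π a b ≤ 1 := fun a b => altFourArmProbAt_le_one t a b
  set κ₀ : ℝ := cL * ((r : ℝ) / (2 ^ (l₁ - 1) : ℕ)) ^ (2 - β) with hκ₀
  have hr0 : (0 : ℝ) < r := by exact_mod_cast (show 0 < r by omega)
  have hκ₀0 : 0 < κ₀ := by
    rw [hκ₀]
    exact mul_pos hcL (Real.rpow_pos_of_pos (div_pos hr0 (by positivity)) _)
  set y : ℝ := (2 : ℝ) ^ α with hy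
  have hy1 : 1 < y := Real.one_lt_rpow (by norm_num) hα
  have hgeom : 0 < y / (y - 1) := div_pos (by linarith) (by linarith)
  -- powers of two
  have p2 : ∀ k : ℕ, (2 : ℕ) ^ (k + 1) = 2 * 2 ^ k := fun k => by rw [pow_succ]; ring
  have hl2 : 2 ≤ l := by omega
  have hL1 : 2 ^ (l - 1) ≤ 2 ^ l := Nat.pow_le_pow_right (by norm_num) (by omega)
  have hL2 : 2 ^ l ≤ 2 ^ (l + 2) := Nat.pow_le_pow_right (by norm_num) (by omega)
  have hLl1 : 2 ^ (l₁ + 1) ≤ 2 ^ (l - 1) := Nat.pow_le_pow_right (by norm_num) (by omega)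
  have hrl : r ≤ 2 ^ (l - 2) := hl₁r'.trans (Nat.pow_le_pow_right (by norm_num) (by omega))
  have e1 : 2 ^ l = 2 * 2 ^ (l - 1) := by
    rw [← pow_succ']; congr 1; omega
  have e2 : 2 ^ (l - 1) = 2 * 2 ^ (l - 2) := by
    rw [← pow_succ']; congr 1; omega
  have e3 : 2 ^ (l + 1) = 2 * 2 ^ l := pow_succ' 2 l
  have e4 : 2 ^ (l + 2) = 2 * 2 ^ (l + 1) := pow_succ' 2 (l + 1)
  -- the fixed-ratio lower bounds `π(M, 2M) ≥ c_L / 4`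
  have hquarter : (1 : ℝ) / 4 ≤ (1 / 2 : ℝ) ^ (2 - β) := by
    calc (1 : ℝ) / 4 = (1 / 2) ^ (2 : ℝ) := by norm_num
      _ ≤ (1 / 2 : ℝ) ^ (2 - β) :=
          Real.rpow_le_rpow_of_exponent_ge (by norm_num) (by norm_num) (by linarith)
  have hratio : ∀ M : ℕ, r ≤ M → 2 * M ≤ N → cL / 4 ≤ π M (2 * M) := by
    intro M hM hMN
    have hM0 : (0 : ℝ) < M := by exact_mod_cast (show 0 < M by omega)
    have h := hL M (2 * M) hM (by omega) hMN
    have hhalf : ((M : ℝ) / ((2 * M : ℕ) : ℝ)) = 1 / 2 := by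
      push_cast; field_simp
    rw [hhalf] at h
    calc cL / 4 = cL * (1 / 4) := by ring
      _ ≤ cL * (1 / 2 : ℝ) ^ (2 - β) := mul_le_mul_of_nonneg_left hquarter hcL.le
      _ ≤ π M (2 * M) := h
  -- inner terms: `π(1, d) ≤ (4/(cQ cL)) π(r, 2^l)` when `2^l ≤ 8d ≤ N`, `4r < d`
  have term_inner : ∀ d : ℕ, r ≤ d → 16 * r < 4 * d → 8 * d ≤ N → 2 ^ l ≤ 8 * d →
      π 1 d ≤ 4 / (cQ * cL) * π r (2 ^ l) := by
    intro d hrd h16 h8dN h8d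
    have hq := hQ r d (8 * d) le_rfl h16 (by omega) h8dN
    have hlow : cL / 4 ≤ π (4 * d) (8 * d) := by
      have := hratio (4 * d) (by omega) (by omega)
      rwa [show 2 * (4 * d) = 8 * d by ring] at this
    have h1 : π r d ≤ π r (8 * d) / (cQ * (cL / 4)) :=
      le_div_of_quasiMult_right hcQ (by positivity) (hπ0 _ _) hlow hq
    calc π 1 d ≤ π r d := altFourArmProbAt_mono_left t (by omega) hrd
      _ ≤ π r (8 * d) / (cQ * (cL / 4)) := h1
      _ ≤ π r (2 ^ l) / (cQ * (cL / 4)) :=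
          div_le_div_of_nonneg_right (altFourArmProbAt_anti t _ (by omega) h8d) (by positivity)
      _ = 4 / (cQ * cL) * π r (2 ^ l) := by field_simp
  -- the fifth arm costs a one-arm probability
  have six_le : ∀ a : ℕ, 1 ≤ a → a ≤ 2 ^ l →
      π a (2 ^ l) * μ.real (armEvent ![c] a (2 ^ l)) ≤
        π a (2 ^ l) * (CA * ((a : ℝ) / ((2 ^ l : ℕ) : ℝ)) ^ α) := fun a ha hal =>
    mul_le_mul_of_nonneg_left (hA c a (2 ^ l) ha hal (by omega)) (hπ0 _ _)
  -- the ratios `ρ(l') = (2^{l'+1}/2^l)^α ≤ 1`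
  have hρ1 : ∀ l' : ℕ, l' + 1 ≤ l → (((2 ^ (l' + 1) : ℕ) : ℝ) / ((2 ^ l : ℕ) : ℝ)) ^ α ≤ 1 := by
    intro l' hl'
    apply Real.rpow_le_one (by positivity) _ hα.le
    rw [div_le_one (by positivity)]
    exact_mod_cast Nat.pow_le_pow_right (by norm_num) hl'
  have hρ0 : ∀ l' : ℕ, 0 ≤ (((2 ^ (l' + 1) : ℕ) : ℝ) / ((2 ^ l : ℕ) : ℝ)) ^ α := fun l' =>
    Real.rpow_nonneg (by positivity) _
  -- TERM 1
  have hT1 : π 1 (2 ^ (l - 1)) ≤ 4 / (cQ * cL) * π r (2 ^ l) :=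
    term_inner (2 ^ (l - 1)) (by omega) (by omega) (by omega) (by omega)
  -- TERM 2
  have hT2 : π 2 (2 ^ l) * μ.real (armEvent ![c] 2 (2 ^ l)) ≤ CA * π r (2 ^ l) := by
    have h2l : 2 ≤ 2 ^ l := by
      calc 2 = 2 ^ 1 := by norm_num
        _ ≤ 2 ^ l := Nat.pow_le_pow_right (by norm_num) (by omega)
    have h := six_le 2 (by norm_num) h2l
    have hρ : (((2 : ℕ) : ℝ) / ((2 ^ l : ℕ) : ℝ)) ^ α ≤ 1 := by
      have := hρ1 0 (by omega); simpa using this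
    calc π 2 (2 ^ l) * μ.real (armEvent ![c] 2 (2 ^ l))
        ≤ π 2 (2 ^ l) * (CA * (((2 : ℕ) : ℝ) / ((2 ^ l : ℕ) : ℝ)) ^ α) := by exact_mod_cast h
      _ ≤ π r (2 ^ l) * (CA * 1) := by
          refine mul_le_mul (altFourArmProbAt_mono_left t hr (by omega)) ?_ (by positivity) (hπ0 _ _)
          exact mul_le_mul_of_nonneg_left hρ hCA
      _ = CA * π r (2 ^ l) := by ring
  -- the mid/small terms: `π(1, 2^{l'-1}) S₆(2^{l'+1}) ≤ (CA/cQ)(1 + 1/κ₀) π(r, 2^l) ρ(l')`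
  set Kmid : ℝ := CA / cQ * (1 + 1 / κ₀) with hKmid
  have hKmid0 : 0 ≤ Kmid := by positivity
  -- `π(2^{l₁+1}, 2^l) ≤ π(r, 2^l) / (cQ κ₀)`
  have hfix : π (2 ^ (l₁ + 1)) (2 ^ l) ≤ π r (2 ^ l) / (cQ * κ₀) := by
    have e : 4 * 2 ^ (l₁ - 1) = 2 ^ (l₁ + 1) := by
      rw [show l₁ + 1 = (l₁ - 1) + 2 by omega, pow_add]; ring
    have hq := hQ r (2 ^ (l₁ - 1)) (2 ^ l) le_rfl (by omega) (by
      rw [e]; exact Nat.pow_lt_pow_right (by norm_num) (by omega)) (by omega)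
    rw [e] at hq
    have hlow : κ₀ ≤ π r (2 ^ (l₁ - 1)) := hL r (2 ^ (l₁ - 1)) le_rfl hl₁r' (by omega)
    exact le_div_of_quasiMult_left hcQ hκ₀0 (hπ0 _ _) hlow hq
  have hterm : ∀ l' ∈ Finset.Ico 1 (l - 1),
      π 1 (2 ^ (l' - 1)) * (π (2 ^ (l' + 1)) (2 ^ l) * μ.real (armEvent ![c] (2 ^ (l' + 1)) (2 ^ l))) ≤
        Kmid * π r (2 ^ l) * (((2 ^ (l' + 1) : ℕ) : ℝ) / ((2 ^ l : ℕ) : ℝ)) ^ α := by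
    intro l' hl'
    rw [Finset.mem_Ico] at hl'
    have hl'l : 2 ^ (l' + 1) ≤ 2 ^ l := Nat.pow_le_pow_right (by norm_num) (by omega)
    have hl'lt : 2 ^ (l' + 1) < 2 ^ l := Nat.pow_lt_pow_right (by norm_num) (by omega)
    have hsix := six_le (2 ^ (l' + 1)) Nat.one_le_two_pow hl'l
    set ρ := (((2 ^ (l' + 1) : ℕ) : ℝ) / ((2 ^ l : ℕ) : ℝ)) ^ α with hρ
    have hP0 := hπ0 r (2 ^ l)
    by_cases hsmall : l' < l₁
    · -- drop the inner factor; `π(2^{l'+1}, 2^l) ≤ π(2^{l₁+1}, 2^l) ≤ π(r,2^l)/(cQ κ₀)`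
      have hmono : π (2 ^ (l' + 1)) (2 ^ l) ≤ π (2 ^ (l₁ + 1)) (2 ^ l) :=
        altFourArmProbAt_mono_left t (Nat.pow_le_pow_right (by norm_num) (by omega)) (by omega)
      calc π 1 (2 ^ (l' - 1)) * (π (2 ^ (l' + 1)) (2 ^ l) * μ.real (armEvent ![c] (2 ^ (l' + 1)) (2 ^ l)))
          ≤ 1 * (π (2 ^ (l' + 1)) (2 ^ l) * (CA * ρ)) :=
            mul_le_mul (hπ1 _ _) hsix (mul_nonneg (hπ0 _ _) measureReal_nonneg) zero_le_one
        _ ≤ π r (2 ^ l) / (cQ * κ₀) * (CA * ρ) := by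
            rw [one_mul]
            exact mul_le_mul_of_nonneg_right (hmono.trans hfix) (mul_nonneg hCA (hρ0 l'))
        _ = CA / cQ * (1 / κ₀) * π r (2 ^ l) * ρ := by field_simp
        _ ≤ Kmid * π r (2 ^ l) * ρ := by
            apply mul_le_mul_of_nonneg_right _ (hρ0 l')
            apply mul_le_mul_of_nonneg_right _ hP0
            rw [hKmid]
            apply mul_le_mul_of_nonneg_left _ (by positivity)
            linarith [hκ₀0]
    · -- quasi-multiplicativity at `(r, 2^{l'-1}, 2^l)`
      push Not at hsmall
      have e : 4 * 2 ^ (l' - 1) = 2 ^ (l' + 1) := by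
        rw [show l' + 1 = (l' - 1) + 2 by omega, pow_add]; ring
      have hrl' : r ≤ 2 ^ (l' - 1) := hl₁r'.trans (Nat.pow_le_pow_right (by norm_num) (by omega))
      have h16 : 16 * r < 4 * 2 ^ (l' - 1) := by
        rw [e]
        calc 16 * r < 2 ^ (l₁ + 1) := by omega
          _ ≤ 2 ^ (l' + 1) := Nat.pow_le_pow_right (by norm_num) (by omega)
      have hq := hQ r (2 ^ (l' - 1)) (2 ^ l) le_rfl h16 (by rw [e]; exact hl'lt) (by omega)
      rw [e] at hq
      -- `π(1, 2^{l'-1}) π(2^{l'+1}, 2^l) ≤ π(r, 2^{l'-1}) π(2^{l'+1}, 2^l) ≤ π(r, 2^l)/cQ`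
      have hmono : π 1 (2 ^ (l' - 1)) ≤ π r (2 ^ (l' - 1)) :=
        altFourArmProbAt_mono_left t (by omega) hrl'
      have hprod : π 1 (2 ^ (l' - 1)) * π (2 ^ (l' + 1)) (2 ^ l) ≤ π r (2 ^ l) / cQ := by
        rw [le_div_iff₀ hcQ]
        calc π 1 (2 ^ (l' - 1)) * π (2 ^ (l' + 1)) (2 ^ l) * cQ
            = cQ * (π 1 (2 ^ (l' - 1)) * π (2 ^ (l' + 1)) (2 ^ l)) := by ring
          _ ≤ cQ * (π r (2 ^ (l' - 1)) * π (2 ^ (l' + 1)) (2 ^ l)) := by gcongr; exact hπ0 _ _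
          _ ≤ π r (2 ^ l) := hq
      calc π 1 (2 ^ (l' - 1)) * (π (2 ^ (l' + 1)) (2 ^ l) * μ.real (armEvent ![c] (2 ^ (l' + 1)) (2 ^ l)))
          ≤ π 1 (2 ^ (l' - 1)) * (π (2 ^ (l' + 1)) (2 ^ l) * (CA * ρ)) :=
            mul_le_mul_of_nonneg_left hsix (hπ0 _ _)
        _ = (π 1 (2 ^ (l' - 1)) * π (2 ^ (l' + 1)) (2 ^ l)) * (CA * ρ) := by ring
        _ ≤ π r (2 ^ l) / cQ * (CA * ρ) :=
            mul_le_mul_of_nonneg_right hprod (mul_nonneg hCA (hρ0 l'))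
        _ = CA / cQ * 1 * π r (2 ^ l) * ρ := by field_simp
        _ ≤ Kmid * π r (2 ^ l) * ρ := by
            apply mul_le_mul_of_nonneg_right _ (hρ0 l')
            apply mul_le_mul_of_nonneg_right _ hP0
            rw [hKmid]
            apply mul_le_mul_of_nonneg_left _ (by positivity)
            have : 0 ≤ 1 / κ₀ := by positivity
            linarith
  -- the last term `l' = l - 1`
  have hlast : π 1 (2 ^ (l - 1 - 1)) * (π (2 ^ (l - 1 + 1)) (2 ^ l) * μ.real (armEvent ![c] (2 ^ (l - 1 + 1)) (2 ^ l)))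
      ≤ 4 / (cQ * cL) * π r (2 ^ l) := by
    have h := term_inner (2 ^ (l - 2)) hrl (by omega) (by omega) (by omega)
    rw [show l - 1 - 1 = l - 2 by omega]
    calc π 1 (2 ^ (l - 2)) * (π (2 ^ (l - 1 + 1)) (2 ^ l) * μ.real (armEvent ![c] (2 ^ (l - 1 + 1)) (2 ^ l)))
        ≤ π 1 (2 ^ (l - 2)) * 1 :=
          mul_le_mul_of_nonneg_left (mul_le_one₀ (hπ1 _ _) measureReal_nonneg measureReal_le_one)
            (hπ0 _ _)
      _ ≤ 4 / (cQ * cL) * π r (2 ^ l) := by rw [mul_one]; exact h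
  -- split the sum: `Ico 1 l = Ico 1 (l-1) ∪ {l-1}`
  have hsplit : ∑ l' ∈ Finset.Ico 1 l, π 1 (2 ^ (l' - 1)) *
        (π (2 ^ (l' + 1)) (2 ^ l) * μ.real (armEvent ![c] (2 ^ (l' + 1)) (2 ^ l))) =
      ∑ l' ∈ Finset.Ico 1 (l - 1), π 1 (2 ^ (l' - 1)) *
          (π (2 ^ (l' + 1)) (2 ^ l) * μ.real (armEvent ![c] (2 ^ (l' + 1)) (2 ^ l))) +
        π 1 (2 ^ (l - 1 - 1)) * (π (2 ^ (l - 1 + 1)) (2 ^ l) * μ.real (armEvent ![c] (2 ^ (l - 1 + 1)) (2 ^ l))) := by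
    rw [← Finset.sum_Ico_consecutive _ (show 1 ≤ l - 1 by omega) (show l - 1 ≤ l by omega),
      show l = (l - 1) + 1 from by omega]
    simp
  have hmid : ∑ l' ∈ Finset.Ico 1 (l - 1), π 1 (2 ^ (l' - 1)) *
        (π (2 ^ (l' + 1)) (2 ^ l) * μ.real (armEvent ![c] (2 ^ (l' + 1)) (2 ^ l))) ≤
      Kmid * π r (2 ^ l) * (y / (y - 1)) := by
    calc ∑ l' ∈ Finset.Ico 1 (l - 1), π 1 (2 ^ (l' - 1)) *
          (π (2 ^ (l' + 1)) (2 ^ l) * μ.real (armEvent ![c] (2 ^ (l' + 1)) (2 ^ l)))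
        ≤ ∑ l' ∈ Finset.Ico 1 (l - 1),
            Kmid * π r (2 ^ l) * (((2 ^ (l' + 1) : ℕ) : ℝ) / ((2 ^ l : ℕ) : ℝ)) ^ α :=
          Finset.sum_le_sum hterm
      _ = Kmid * π r (2 ^ l) *
            ∑ l' ∈ Finset.Ico 1 (l - 1), (((2 ^ (l' + 1) : ℕ) : ℝ) / ((2 ^ l : ℕ) : ℝ)) ^ α := by
          rw [Finset.mul_sum]
      _ ≤ Kmid * π r (2 ^ l) * (y / (y - 1)) :=
          mul_le_mul_of_nonneg_left (sum_dyadic_ratio_rpow_le hα l) (mul_nonneg hKmid0 (hπ0 _ _))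
  -- assemble
  have hP0 := hπ0 r (2 ^ l)
  have hK1 : 4 / (cQ * cL) ≤ 8 / (cQ * cL) * (1 + CA) := by
    have h1 : 0 < cQ * cL := mul_pos hcQ hcL
    rw [div_le_iff₀ h1]
    have : 8 / (cQ * cL) * (1 + CA) * (cQ * cL) = 8 * (1 + CA) := by field_simp
    rw [this]; nlinarith
  calc π 1 (2 ^ (l - 1)) + π 2 (2 ^ l) * μ.real (armEvent ![c] 2 (2 ^ l)) +
        ∑ l' ∈ Finset.Ico 1 l, π 1 (2 ^ (l' - 1)) *
          (π (2 ^ (l' + 1)) (2 ^ l) * μ.real (armEvent ![c] (2 ^ (l' + 1)) (2 ^ l)))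
      ≤ 4 / (cQ * cL) * π r (2 ^ l) + CA * π r (2 ^ l) +
          (Kmid * π r (2 ^ l) * (y / (y - 1)) + 4 / (cQ * cL) * π r (2 ^ l)) := by
        rw [hsplit]
        exact add_le_add (add_le_add hT1 hT2) (add_le_add hmid hlast)
    _ = (4 / (cQ * cL) + 4 / (cQ * cL) + CA + Kmid * (y / (y - 1))) * π r (2 ^ l) := by ring
    _ ≤ (8 / (cQ * cL) * (1 + CA) + CA + Kmid * (y / (y - 1))) * π r (2 ^ l) := by
        apply mul_le_mul_of_nonneg_right _ hP0
        have h0 : 0 ≤ 8 / (cQ * cL) := by positivity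
        have hK2 : 4 / (cQ * cL) + 4 / (cQ * cL) ≤ 8 / (cQ * cL) * (1 + CA) := by
          have e : 8 / (cQ * cL) * (1 + CA) = (4 / (cQ * cL) + 4 / (cQ * cL)) + 8 / (cQ * cL) * CA := by
            ring
          rw [e]; linarith [mul_nonneg h0 hCA]
        linarith [hK2]

end LocalFactor

end Literature.Probability.Percolation
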